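import Literature.MathematicalPhysics.QuantumLattice.HubbardNormalCovarianceDetBound
import Literature.MathematicalPhysics.QuantumLattice.HubbardUVSymbolCTDifferences
import HarnessLib

/-!
# The K-RESUMMED scale-`Λ` covariance of the counterterm frame is determinant-bounded on the `4M` grid, with a constant of the same
# size as the un-resummed one (de Siqueira Pedra–Salmhofer 2008, Thm 1.3 / 2.4, via `HubbardNormalCovarianceDetBound`)

Topic `MathematicalPhysics/QuantumLattice`; cell gate-hubbard-kl, K3 engine two-leg lane, repair (ρ2)(iii) (GLOBAL-MOMENTUM-SIZES finding).
Resumming the quadratic counterterm vertex `𝒩_K` into the CT cutoff covariance `C^K_{>Λ} = normalCovariance Ψ`, `Ψ = uvSymbolCT … K Λ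
= βL²·w^K_Λ/(−iν + e_K)`, gives the normal covariance with symbol `Ψ̃ = Ψ/(1 + Ψ·K(p_k⃗)/(βL²)) = βL²·w/(−iν + e_K + w·K(p_k⃗))`
(`HubbardCounterQuadraticResummation`).  As long as the frame is small against the scale, `|K(p_k⃗)| ≤ k_max ≤ Λ/4` (scale `0` of the
KL programme: `Λ = e₀`, `|K| = O(U)`), the resummed denominator keeps half of `|−iν + e_K|` on the support of `w`, the remainder after the
chronological kernel is `‖Ψ̃/(βL²) − 1/(−iν + e_K)‖ ≤ 2(1 − w)/√(ν² + e_K²) + 10·k_max/(ν² + Λ²)`, and the fermionic sum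
`Σ_i 1/(ν_i² + Λ²) ≤ β/(2Λ)` makes the second piece mode-averaged `≤ 5 k_max/Λ`:

* `norm_resummedRemainder_le` — the pointwise remainder bound (pure complex arithmetic);
* `uvSymbolCT_div_eq`, `resummedSymbol_div_eq` — `Ψ/(βL²) = w/(−iν + e_K)`, `Ψ̃/(βL²) = w/(−iν + e_K + wK)`; `one_add_uvSymbolCT_mul_ne_zero`
  (the resummation denominator NEVER vanishes: `1 + Ψκ = (−iν + e_K + wK)/(−iν + e_K)`, `ν ≠ 0`);
* **`isDetBoundedR_gridSub_resummedCovariance`** — for `0 < β`, `0 < Λ`, `|K(p_k⃗)| ≤ k_max ≤ Λ/4` and the usual infrared Gram hypothesis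
  `(βL²)⁻¹ Σ (1 − w^K_Λ)/√(ν² + e_K²) ≤ κ²`: `IsDetBoundedR q (Sᵀ · normalCovariance Ψ̃ · S) √(2(7 + (2κ² + 5k_max/Λ)))`, every `M`.

Everything is PROVED; no definitions (the resummed symbol is written out); no named facts.  NOT claimed: anything at scales with
`Λ_n < 4‖K‖_∞` (there `−iν + e_K + w_nK` vanishes on a surface inside the transition shell up to `|ν| ≥ π/β` and no scale-like constant exists).

## Sources

W. de Siqueira Pedra, M. Salmhofer, Comm. Math. Phys. 282 (2008) 797–818, Thm 1.3, Thm 2.4 [`PedraSalmhofer2008`];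
J. Feldman, M. Salmhofer, E. Trubowitz, J. Stat. Phys. 84 (1996) 1209–1336, §1 [`FeldmanSalmhoferTrubowitz1996`].
-/

noncomputable section

open Finset

open scoped InnerProductSpace ComplexConjugate

namespace Literature.MathematicalPhysics.QuantumLattice

open Literature.Probability.LatticeModels GrassmannAlgebra

/-! ### Pure complex arithmetic: the resummed remainder -/

/-- The modulus of `-iν + e` is `√(ν² + e²)`. [cite: PedraSalmhofer2008, Thm 2.4] -/
theorem norm_neg_ofReal_mul_I_add (ν e : ℝ) : ‖-(ν : ℂ) * Complex.I + e‖ = Real.sqrt (ν ^ 2 + e ^ 2) := by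
  rw [Complex.norm_def, Complex.normSq_apply]
  congr 1
  simp
  ring

/-- `-iν + e ≠ 0` for `ν ≠ 0`. [cite: PedraSalmhofer2008, Thm 2.4] -/
theorem neg_ofReal_mul_I_add_ne_zero {ν : ℝ} (hν : ν ≠ 0) (e : ℝ) : (-(ν : ℂ) * Complex.I + e) ≠ 0 := by
  intro h
  have := congrArg Complex.im h
  simp at this
  exact hν (by linarith)

/-- The resummed denominator `-iν + e + wK` has imaginary part `-ν ≠ 0`. [cite: FeldmanSalmhoferTrubowitz1996, §1] -/
theorem neg_ofReal_mul_I_add_add_ne_zero {ν : ℝ} (hν : ν ≠ 0) (e w K : ℝ) :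
    (-(ν : ℂ) * Complex.I + e + (w : ℂ) * (K : ℂ)) ≠ 0 := by
  intro h
  have := congrArg Complex.im h
  simp at this
  exact hν (by linarith)

/-- **The resummed remainder**: for `ν ≠ 0`, `0 ≤ w ≤ 1` and `w|K| ≤ ½‖−iν + e‖`,
`‖w/(−iν + e + wK) − 1/(−iν + e)‖ ≤ 2(1 − w)/‖−iν + e‖ + 2w|K|/‖−iν + e‖²`. [cite: PedraSalmhofer2008, Thm 2.4] -/
theorem norm_resummedRemainder_le {ν : ℝ} (hν : ν ≠ 0) (e : ℝ) {w : ℝ} (hw0 : 0 ≤ w) (hw1 : w ≤ 1) (K : ℝ)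
    (hK : w * |K| ≤ ‖-(ν : ℂ) * Complex.I + e‖ / 2) :
    ‖(w : ℂ) / (-(ν : ℂ) * Complex.I + e + (w : ℂ) * (K : ℂ)) - 1 / (-(ν : ℂ) * Complex.I + e)‖ ≤
      2 * (1 - w) / ‖-(ν : ℂ) * Complex.I + e‖ + 2 * w * |K| / ‖-(ν : ℂ) * Complex.I + e‖ ^ 2 := by
  set z : ℂ := -(ν : ℂ) * Complex.I + e with hz
  set D : ℂ := z + (w : ℂ) * (K : ℂ) with hD
  have hz0 : z ≠ 0 := neg_ofReal_mul_I_add_ne_zero hν e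
  have hD0 : D ≠ 0 := by rw [hD, hz]; exact neg_ofReal_mul_I_add_add_ne_zero hν e w K
  have hzpos : 0 < ‖z‖ := norm_pos_iff.2 hz0
  -- `‖D‖ ≥ ‖z‖/2`
  have hDge : ‖z‖ / 2 ≤ ‖D‖ := by
    have h1 : ‖z‖ - ‖(w : ℂ) * (K : ℂ)‖ ≤ ‖D‖ := by
      have := norm_sub_norm_le z (-((w : ℂ) * (K : ℂ)))
      rw [norm_neg, sub_neg_eq_add] at this
      exact this
    have h2 : ‖(w : ℂ) * (K : ℂ)‖ = w * |K| := by
      rw [norm_mul, Complex.norm_real, Complex.norm_real, Real.norm_eq_abs, Real.norm_eq_abs, abs_of_nonneg hw0]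
    rw [h2] at h1
    linarith
  have hDpos : 0 < ‖D‖ := lt_of_lt_of_le (by positivity) hDge
  -- the algebra: `w/D − 1/z = (−(1−w) z − wK)/(z D)`
  have hD0' : z + (w : ℂ) * (K : ℂ) ≠ 0 := hD0
  have halg : (w : ℂ) / D - 1 / z = (-(((1 - w : ℝ) : ℂ)) * z - (w : ℂ) * (K : ℂ)) / (z * D) := by
    simp only [hD]
    rw [div_sub_div _ _ hD0' hz0, div_eq_div_iff (mul_ne_zero hD0' hz0) (mul_ne_zero hz0 hD0')]
    push_cast
    ring
  rw [halg, norm_div, norm_mul]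
  have hnum : ‖-(((1 - w : ℝ) : ℂ)) * z - (w : ℂ) * (K : ℂ)‖ ≤ (1 - w) * ‖z‖ + w * |K| := by
    refine (norm_sub_le _ _).trans ?_
    rw [norm_mul, norm_neg, Complex.norm_real, Real.norm_eq_abs, abs_of_nonneg (by linarith), norm_mul, Complex.norm_real,
      Complex.norm_real, Real.norm_eq_abs, Real.norm_eq_abs, abs_of_nonneg hw0]
  calc ‖-(((1 - w : ℝ) : ℂ)) * z - (w : ℂ) * (K : ℂ)‖ / (‖z‖ * ‖D‖)
      ≤ ((1 - w) * ‖z‖ + w * |K|) / (‖z‖ * (‖z‖ / 2)) := by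
        refine div_le_div₀ (by positivity) hnum (by positivity) ?_
        exact mul_le_mul_of_nonneg_left hDge hzpos.le
    _ = 2 * (1 - w) / ‖z‖ + 2 * w * |K| / ‖z‖ ^ 2 := by
        field_simp

/-! ### The resummed symbol -/

section Symbol

variable {L M : ℕ} [NeZero L]

/-- **`Ψ/(βL²) = w/(−iν + e_K)`** for the CT cutoff symbol at a nonzero frequency. [cite: PedraSalmhofer2008, Thm 2.4] -/
theorem uvSymbolCT_div_eq {β : ℝ} (hβ : 0 < β) (μ : ℝ) (K : TrigPolyC4v) (Λ : ℝ) (i : MatsubaraIdx M) (kv : TorusSite 2 L)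
    (s : Fin 2) :
    uvSymbolCT L M β μ K Λ ((i, kv), s) / ((β * (L : ℝ) ^ 2 : ℝ) : ℂ) =
      (hubbardCutoffWeightCT L M β μ K Λ (i, kv) : ℂ) /
        (-((matsubaraFreq β M i : ℝ) : ℂ) * Complex.I + (nambuXiCT L μ K kv : ℂ)) := by
  have hν : matsubaraFreq β M i ≠ 0 := matsubaraFreq_ne_zero hβ.ne' i
  have hL : (0 : ℝ) < L := by exact_mod_cast Nat.pos_of_ne_zero (NeZero.ne L)
  have hβL : ((β * (L : ℝ) ^ 2 : ℝ) : ℂ) ≠ 0 := by exact_mod_cast (by positivity : (0:ℝ) < β * (L : ℝ) ^ 2).ne'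
  have hz := neg_ofReal_mul_I_add_ne_zero hν (nambuXiCT L μ K kv)
  have hden : ((nambuDenCT L M β μ 0 K (i, kv) : ℝ) : ℂ) ≠ 0 := by
    have : 0 < nambuDenCT L M β μ 0 K (i, kv) := by
      simp only [nambuDenCT, zero_mul]
      positivity
    exact_mod_cast this.ne'
  unfold uvSymbolCT
  simp only
  have hd : (nambuDenCT L M β μ 0 K (i, kv) : ℝ) = matsubaraFreq β M i ^ 2 + nambuXiCT L μ K kv ^ 2 := by
    simp [nambuDenCT]
  rw [div_eq_div_iff hβL hz]
  rw [hd] at hden ⊢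
  field_simp
  push_cast
  ring_nf
  rw [Complex.I_sq]
  ring

/-- `1 + Ψ·K(p_k⃗)/(βL²) = (−iν + e_K + wK)/(−iν + e_K)`. [cite: FeldmanSalmhoferTrubowitz1996, §1] -/
theorem one_add_uvSymbolCT_mul_eq {β : ℝ} (hβ : 0 < β) (μ : ℝ) (K : TrigPolyC4v) (Λ : ℝ) (i : MatsubaraIdx M) (kv : TorusSite 2 L)
    (s : Fin 2) :
    1 + uvSymbolCT L M β μ K Λ ((i, kv), s) * ((K.eval (latticeMomentum L kv) / (β * (L : ℝ) ^ 2) : ℝ) : ℂ) =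
      (-((matsubaraFreq β M i : ℝ) : ℂ) * Complex.I + (nambuXiCT L μ K kv : ℂ) +
          (hubbardCutoffWeightCT L M β μ K Λ (i, kv) : ℂ) * (K.eval (latticeMomentum L kv) : ℂ)) /
        (-((matsubaraFreq β M i : ℝ) : ℂ) * Complex.I + (nambuXiCT L μ K kv : ℂ)) := by
  have hν : matsubaraFreq β M i ≠ 0 := matsubaraFreq_ne_zero hβ.ne' i
  have hL : (0 : ℝ) < L := by exact_mod_cast Nat.pos_of_ne_zero (NeZero.ne L)
  have hβL0 : (0 : ℝ) < β * (L : ℝ) ^ 2 := by positivity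
  have hβL : ((β * (L : ℝ) ^ 2 : ℝ) : ℂ) ≠ 0 := by exact_mod_cast hβL0.ne'
  have hz := neg_ofReal_mul_I_add_ne_zero hν (nambuXiCT L μ K kv)
  have hΨ : uvSymbolCT L M β μ K Λ ((i, kv), s) = ((β * (L : ℝ) ^ 2 : ℝ) : ℂ) *
      ((hubbardCutoffWeightCT L M β μ K Λ (i, kv) : ℂ) / (-((matsubaraFreq β M i : ℝ) : ℂ) * Complex.I + (nambuXiCT L μ K kv : ℂ))) := by
    rw [← uvSymbolCT_div_eq hβ μ K Λ i kv s]
    field_simp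
  have hk : ((K.eval (latticeMomentum L kv) / (β * (L : ℝ) ^ 2) : ℝ) : ℂ) =
      (K.eval (latticeMomentum L kv) : ℂ) / ((β * (L : ℝ) ^ 2 : ℝ) : ℂ) := by
    push_cast
    rfl
  set z : ℂ := -((matsubaraFreq β M i : ℝ) : ℂ) * Complex.I + (nambuXiCT L μ K kv : ℂ) with hzdef
  rw [hΨ, hk, eq_div_iff hz]
  field_simp

/-- **The resummation denominator never vanishes**: `1 + Ψ·K(p_k⃗)/(βL²) ≠ 0` (its product with `−iν + e_K` is `−iν + e_K + wK`, whose
imaginary part is `−ν ≠ 0`). [cite: FeldmanSalmhoferTrubowitz1996, §1] -/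
theorem one_add_uvSymbolCT_mul_ne_zero {β : ℝ} (hβ : 0 < β) (μ : ℝ) (K : TrigPolyC4v) (Λ : ℝ) (ks : FreqMomentum L M × Fin 2) :
    1 + uvSymbolCT L M β μ K Λ ks * ((K.eval (latticeMomentum L ks.1.2) / (β * (L : ℝ) ^ 2) : ℝ) : ℂ) ≠ 0 := by
  obtain ⟨⟨i, kv⟩, s⟩ := ks
  rw [one_add_uvSymbolCT_mul_eq hβ μ K Λ i kv s]
  exact div_ne_zero (neg_ofReal_mul_I_add_add_ne_zero (matsubaraFreq_ne_zero hβ.ne' i) _ _ _)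
    (neg_ofReal_mul_I_add_ne_zero (matsubaraFreq_ne_zero hβ.ne' i) _)

/-- **`Ψ̃/(βL²) = w/(−iν + e_K + wK)`** for the resummed symbol. [cite: FeldmanSalmhoferTrubowitz1996, §1] -/
theorem resummedSymbol_div_eq {β : ℝ} (hβ : 0 < β) (μ : ℝ) (K : TrigPolyC4v) (Λ : ℝ) (i : MatsubaraIdx M) (kv : TorusSite 2 L)
    (s : Fin 2) :
    uvSymbolCT L M β μ K Λ ((i, kv), s) /
          (1 + uvSymbolCT L M β μ K Λ ((i, kv), s) * ((K.eval (latticeMomentum L kv) / (β * (L : ℝ) ^ 2) : ℝ) : ℂ)) /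
        ((β * (L : ℝ) ^ 2 : ℝ) : ℂ) =
      (hubbardCutoffWeightCT L M β μ K Λ (i, kv) : ℂ) /
        (-((matsubaraFreq β M i : ℝ) : ℂ) * Complex.I + (nambuXiCT L μ K kv : ℂ) +
          (hubbardCutoffWeightCT L M β μ K Λ (i, kv) : ℂ) * (K.eval (latticeMomentum L kv) : ℂ)) := by
  have hν : matsubaraFreq β M i ≠ 0 := matsubaraFreq_ne_zero hβ.ne' i
  have hL : (0 : ℝ) < L := by exact_mod_cast Nat.pos_of_ne_zero (NeZero.ne L)
  have hβL0 : (0 : ℝ) < β * (L : ℝ) ^ 2 := by positivity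
  have hβL : ((β * (L : ℝ) ^ 2 : ℝ) : ℂ) ≠ 0 := by exact_mod_cast hβL0.ne'
  have hz := neg_ofReal_mul_I_add_ne_zero hν (nambuXiCT L μ K kv)
  have hD := neg_ofReal_mul_I_add_add_ne_zero hν (nambuXiCT L μ K kv) (hubbardCutoffWeightCT L M β μ K Λ (i, kv))
    (K.eval (latticeMomentum L kv))
  have hΨ : uvSymbolCT L M β μ K Λ ((i, kv), s) = ((β * (L : ℝ) ^ 2 : ℝ) : ℂ) *
      ((hubbardCutoffWeightCT L M β μ K Λ (i, kv) : ℂ) / (-((matsubaraFreq β M i : ℝ) : ℂ) * Complex.I + (nambuXiCT L μ K kv : ℂ))) := by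
    rw [← uvSymbolCT_div_eq hβ μ K Λ i kv s]
    field_simp
  rw [one_add_uvSymbolCT_mul_eq hβ μ K Λ i kv s, hΨ]
  set z : ℂ := -((matsubaraFreq β M i : ℝ) : ℂ) * Complex.I + (nambuXiCT L μ K kv : ℂ) with hzdef
  field_simp

end Symbol

/-! ### The determinant bound -/

section Main

variable {L M : ℕ} [NeZero L]

/-- **The K-resummed CT cutoff covariance on the `4M` grid is determinant-bounded**: for `0 < β`, `0 < Λ`, `0 < M`, a frame with
`|K(p_k⃗)| ≤ k_max ≤ Λ/4` at every lattice momentum, and the infrared Gram hypothesis `(βL²)⁻¹ Σ (1 − w^K_Λ)/√(ν² + e_K²) ≤ κ²`,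
`IsDetBoundedR q ((hubbardGridSub …)ᵀ · normalCovariance Ψ̃ · hubbardGridSub …) √(2(7 + (2κ² + 5k_max/Λ)))`,
`Ψ̃ = Ψ/(1 + Ψ·K(p_k⃗)/(βL²))`, `Ψ = uvSymbolCT L M β μ K Λ` — for EVERY `M` (no `log M`). [cite: PedraSalmhofer2008, Thm 1.3] -/
theorem isDetBoundedR_gridSub_resummedCovariance {β : ℝ} (hβ : 0 < β) (μ : ℝ) (K : TrigPolyC4v) {Λ : ℝ} (hΛ : 0 < Λ) [NeZero M]
    {kmax : ℝ} (hKmax : ∀ kv : TorusSite 2 L, |K.eval (latticeMomentum L kv)| ≤ kmax) (hkΛ : kmax ≤ Λ / 4)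
    {κ : ℝ}
    (hIR : 1 / (β * (L : ℝ) ^ 2) * ∑ k : FreqMomentum L M,
        (1 - hubbardCutoffWeightCT L M β μ K Λ k) / Real.sqrt (matsubaraFreq β M k.1 ^ 2 + nambuXiCT L μ K k.2 ^ 2) ≤ κ ^ 2) :
    IsDetBoundedR (fun X : GridLeg (GridPoint L (2 * (2 * M))) => decide (X.2 = 0))
      ((hubbardGridSub L M β (2 * (2 * M))).transpose *
        normalCovariance L M (fun ks => uvSymbolCT L M β μ K Λ ks /
          (1 + uvSymbolCT L M β μ K Λ ks * ((K.eval (latticeMomentum L ks.1.2) / (β * (L : ℝ) ^ 2) : ℝ) : ℂ))) *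
        hubbardGridSub L M β (2 * (2 * M)))
      (Real.sqrt (2 * (7 + (2 * κ ^ 2 + 5 * kmax / Λ)))) := by
  have hL : (0 : ℝ) < L := by exact_mod_cast Nat.pos_of_ne_zero (NeZero.ne L)
  have hβL0 : (0 : ℝ) < β * (L : ℝ) ^ 2 := by positivity
  have hkmax0 : 0 ≤ kmax := (abs_nonneg _).trans (hKmax 0)
  -- the spin-independent resummed symbol
  set p₀ : FreqMomentum L M → ℂ := fun k => uvSymbolCT L M β μ K Λ (k, 0) /
    (1 + uvSymbolCT L M β μ K Λ (k, 0) * ((K.eval (latticeMomentum L k.2) / (β * (L : ℝ) ^ 2) : ℝ) : ℂ)) with hp₀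
  have hsym : (fun ks : FreqMomentum L M × Fin 2 => uvSymbolCT L M β μ K Λ ks /
        (1 + uvSymbolCT L M β μ K Λ ks * ((K.eval (latticeMomentum L ks.1.2) / (β * (L : ℝ) ^ 2) : ℝ) : ℂ))) =
      fun ks => p₀ ks.1 := by
    funext ks
    obtain ⟨k, s⟩ := ks
    simp only [hp₀, uvSymbolCT]
  rw [hsym]
  -- the constant
  have hκ' : (Real.sqrt (2 * κ ^ 2 + 5 * kmax / Λ)) ^ 2 = 2 * κ ^ 2 + 5 * kmax / Λ :=
    Real.sq_sqrt (by positivity)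
  rw [← hκ']
  refine isDetBoundedR_gridSub_normalCovariance hβ (nambuXiCT L μ K) p₀ ?_
  rw [hκ']
  -- the pointwise remainder bound
  set w : FreqMomentum L M → ℝ := fun k => hubbardCutoffWeightCT L M β μ K Λ k with hw
  have hw01 : ∀ k : FreqMomentum L M, 0 ≤ w k ∧ w k ≤ 1 := fun k =>
    salmhoferCutoff_mem_Icc ((matsubaraFreq β M k.1 ^ 2 + nambuXiCT L μ K k.2 ^ 2) / Λ ^ 2)
  have hwzero : ∀ k : FreqMomentum L M, matsubaraFreq β M k.1 ^ 2 + nambuXiCT L μ K k.2 ^ 2 ≤ Λ ^ 2 / 4 → w k = 0 := by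
    intro k hk
    simp only [hw, hubbardCutoffWeightCT]
    exact salmhoferCutoff_of_le (by rw [div_le_iff₀ (by positivity)]; linarith)
  have hpt : ∀ k : FreqMomentum L M,
      ‖p₀ k / ((β * (L : ℝ) ^ 2 : ℝ) : ℂ) - 1 / (-((matsubaraFreq β M k.1 : ℝ) : ℂ) * Complex.I + (nambuXiCT L μ K k.2 : ℂ))‖ ≤
        2 * ((1 - w k) / Real.sqrt (matsubaraFreq β M k.1 ^ 2 + nambuXiCT L μ K k.2 ^ 2)) +
          10 * kmax * (1 / (matsubaraFreq β M k.1 ^ 2 + Λ ^ 2)) := by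
    intro k
    obtain ⟨i, kv⟩ := k
    have hν : matsubaraFreq β M i ≠ 0 := matsubaraFreq_ne_zero hβ.ne' i
    set ν := matsubaraFreq β M i with hνdef
    set e := nambuXiCT L μ K kv with hedef
    set Kp := K.eval (latticeMomentum L kv) with hKp
    have hz0 := neg_ofReal_mul_I_add_ne_zero hν e
    have hzn : ‖-(ν : ℂ) * Complex.I + e‖ = Real.sqrt (ν ^ 2 + e ^ 2) := norm_neg_ofReal_mul_I_add ν e
    have hzpos : 0 < Real.sqrt (ν ^ 2 + e ^ 2) := Real.sqrt_pos.2 (by positivity)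
    -- the resummed symbol over `βL²`
    have hres : p₀ (i, kv) / ((β * (L : ℝ) ^ 2 : ℝ) : ℂ) =
        (w (i, kv) : ℂ) / (-(ν : ℂ) * Complex.I + e + (w (i, kv) : ℂ) * (Kp : ℂ)) := by
      simp only [hp₀, hw, hνdef, hedef, hKp]
      exact resummedSymbol_div_eq hβ μ K Λ i kv 0
    rw [hres]
    -- `w|K| ≤ ‖z‖/2`
    have hwK : w (i, kv) * |Kp| ≤ ‖-(ν : ℂ) * Complex.I + e‖ / 2 := by
      by_cases hsmall : ν ^ 2 + e ^ 2 ≤ Λ ^ 2 / 4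
      · rw [hwzero (i, kv) hsmall, zero_mul]; positivity
      · push Not at hsmall
        have hzge : Λ / 2 ≤ Real.sqrt (ν ^ 2 + e ^ 2) := by
          rw [show Λ / 2 = Real.sqrt ((Λ / 2) ^ 2) by rw [Real.sqrt_sq (by positivity)]]
          exact Real.sqrt_le_sqrt (by nlinarith)
        rw [hzn]
        calc w (i, kv) * |Kp| ≤ 1 * kmax := mul_le_mul (hw01 (i, kv)).2 (hKmax kv) (abs_nonneg _) zero_le_one
          _ ≤ Real.sqrt (ν ^ 2 + e ^ 2) / 2 := by linarith
    have hmain := norm_resummedRemainder_le hν e (hw01 (i, kv)).1 (hw01 (i, kv)).2 Kp hwK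
    refine hmain.trans ?_
    rw [hzn, Real.sq_sqrt (by positivity)]
    have hsecond : 2 * w (i, kv) * |Kp| / (ν ^ 2 + e ^ 2) ≤ 10 * kmax * (1 / (ν ^ 2 + Λ ^ 2)) := by
      by_cases hsmall : ν ^ 2 + e ^ 2 ≤ Λ ^ 2 / 4
      · rw [hwzero (i, kv) hsmall]; simp; positivity
      · push Not at hsmall
        have hwk1 : w (i, kv) * |Kp| ≤ kmax := by
          calc w (i, kv) * |Kp| ≤ 1 * kmax := mul_le_mul (hw01 (i, kv)).2 (hKmax kv) (abs_nonneg _) zero_le_one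
            _ = kmax := one_mul _
        -- `1/(ν²+e²) ≤ 5/(ν²+Λ²)` on the support of `w`
        have hinv : 1 / (ν ^ 2 + e ^ 2) ≤ 5 / (ν ^ 2 + Λ ^ 2) := by
          rw [div_le_div_iff₀ (by positivity) (by positivity)]
          by_cases hνΛ : Λ ^ 2 ≤ 4 * ν ^ 2
          · nlinarith [sq_nonneg e]
          · push Not at hνΛ
            nlinarith
        calc 2 * w (i, kv) * |Kp| / (ν ^ 2 + e ^ 2) = 2 * (w (i, kv) * |Kp|) * (1 / (ν ^ 2 + e ^ 2)) := by ring
          _ ≤ 2 * kmax * (5 / (ν ^ 2 + Λ ^ 2)) :=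
              mul_le_mul (by linarith) hinv (by positivity) (by positivity)
          _ = 10 * kmax * (1 / (ν ^ 2 + Λ ^ 2)) := by ring
    have hfirst : 2 * (1 - w (i, kv)) / Real.sqrt (ν ^ 2 + e ^ 2) = 2 * ((1 - w (i, kv)) / Real.sqrt (ν ^ 2 + e ^ 2)) := by ring
    linarith
  -- sum the pointwise bound
  have hsum : 1 / (β * (L : ℝ) ^ 2) * ∑ k : FreqMomentum L M,
      ‖p₀ k / ((β * (L : ℝ) ^ 2 : ℝ) : ℂ) - 1 / (-((matsubaraFreq β M k.1 : ℝ) : ℂ) * Complex.I + (nambuXiCT L μ K k.2 : ℂ))‖ ≤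
      1 / (β * (L : ℝ) ^ 2) * ∑ k : FreqMomentum L M,
        (2 * ((1 - w k) / Real.sqrt (matsubaraFreq β M k.1 ^ 2 + nambuXiCT L μ K k.2 ^ 2)) +
          10 * kmax * (1 / (matsubaraFreq β M k.1 ^ 2 + Λ ^ 2))) :=
    mul_le_mul_of_nonneg_left (sum_le_sum fun k _ => hpt k) (by positivity)
  refine hsum.trans ?_
  rw [sum_add_distrib, ← mul_sum, ← mul_sum, mul_add]
  -- first piece: `2κ²`
  have h1 : 1 / (β * (L : ℝ) ^ 2) * (2 * ∑ k : FreqMomentum L M,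
      (1 - w k) / Real.sqrt (matsubaraFreq β M k.1 ^ 2 + nambuXiCT L μ K k.2 ^ 2)) ≤ 2 * κ ^ 2 := by
    have := hIR
    simp only [hw]
    nlinarith
  -- second piece: `5 kmax / Λ` by the fermionic Matsubara sum
  have h2 : 1 / (β * (L : ℝ) ^ 2) * (10 * kmax * ∑ k : FreqMomentum L M, 1 / (matsubaraFreq β M k.1 ^ 2 + Λ ^ 2)) ≤
      5 * kmax / Λ := by
    have hfreq := sum_matsubaraIdx_inv_sq_add_sq_le hβ hΛ M
    have hsplit : ∑ k : FreqMomentum L M, 1 / (matsubaraFreq β M k.1 ^ 2 + Λ ^ 2) =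
        (L : ℝ) ^ 2 * ∑ i : MatsubaraIdx M, 1 / (matsubaraFreq β M i ^ 2 + Λ ^ 2) := by
      rw [Fintype.sum_prod_type]
      simp only [sum_const, card_univ, nsmul_eq_mul]
      have hcard : (Fintype.card (TorusSite 2 L) : ℝ) = (L : ℝ) ^ 2 := by
        rw [Fintype.card_pi, Fin.prod_const, ZMod.card]
        push_cast
        ring
      rw [← mul_sum, hcard]
    rw [hsplit]
    have hβne : β ≠ 0 := hβ.ne'
    have hLne : (L : ℝ) ≠ 0 := hL.ne'
    calc 1 / (β * (L : ℝ) ^ 2) * (10 * kmax * ((L : ℝ) ^ 2 * ∑ i : MatsubaraIdx M, 1 / (matsubaraFreq β M i ^ 2 + Λ ^ 2)))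
        = 10 * kmax * (1 / β * ∑ i : MatsubaraIdx M, 1 / (matsubaraFreq β M i ^ 2 + Λ ^ 2)) := by
          field_simp
      _ ≤ 10 * kmax * (1 / β * (β / (2 * Λ))) := by gcongr
      _ = 5 * kmax / Λ := by field_simp; ring
  linarith

end Main

end Literature.MathematicalPhysics.QuantumLattice

end
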